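import Summits.QuantumFields.YangMills.Theorems.BalabanLadderNTConjugateResponse
import Summits.QuantumFields.YangMills.Theorems.BalabanLadderInfVolRPSquare
import Summits.QuantumFields.YangMills.Theorems.LangevinControlUVOSLegsFromFemtoAndGapStubAssemblyPermutations
import Summits.QuantumFields.YangMills.Theorems.HypercubicLimit.Negative.TelescopingGuards
import Summits.QuantumFields.YangMills.Theorems.BalabanLadderNTCumulantPolarisationDefs
import Summits.QuantumFields.YangMills.Theorems.BalabanLadderInfVolTranslations
import HarnessLib

/-!
# Route `SquareRootCeilings`, support `MirrorDomination` (stmt-QuantumFields-26792), I: the reflection-positivity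
# Cauchy–Schwarz inequality for a pair of single-plane plaquette fields on the odd torus, and the symmetries used

Toolkit for `Theorems/SquareRootCeilingsMirrorDomination.lean` (the item itself).  Everything is about the torus
state `torusE G r β L` (Wilson's measure on `(ℤ/(2L+1))⁴`, arbitrary compact `G`, arbitrary lattice representation `r`)
evaluated on the single-plane fields `plane G r q x` of the tree (`DlrCollarTransfer.plane`):

* §1 symmetries of the centred two-point function `E[(P_q(x) − E P_q(x))(P_q'(y) − E P_q'(y))]`: translation
  invariance (`cov_translate`, from `torusE_comp_configShift` and `InfiniteVolume.plane_add`), symmetry, periodicity in the base point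
  (`cov_add_period`, torus aliasing of the lift), uncentring (`cov_eq_sub`);
* §2 `rpcs_plane` — reflection positivity of the Wilson measure across the site mirror `x₀ ↦ −x₀` of the odd torus
  in Cauchy–Schwarz form for two plane fields based in the closed non-negative half (tree
  `Reflection.sq_cov_negReflect_le_odd_pos` + `plane_cfgReflect`): `Cov(P_q(θx),P_q'(y))² ≤ c_q · c_q'` with the two
  mirror forms `≥ 0`;
* §3 `cov_coordPerm` — hypercubic invariance: a coordinate permutation of the base points with re-sorted
  orientations leaves the centred two-point function unchanged (tree `torusMomentStr_coordPerm`, `n = 2`).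

Width seat ym-line-sfw-p2-w2 g21 (free hands) for planner ym-idea-11.  No summit / leaf / NT statement is proved.
[cite: OsterwalderSeiler1978, §2; FrohlichIsraelLiebSimon1978, Thm. 2.1]
-/

set_option autoImplicit false

noncomputable section

open MeasureTheory Filter Topology
open Literature.MathematicalPhysics.QuantumFieldTheory Literature.MathematicalPhysics.QuantumLattice
open Literature.Probability.LatticeModels (Site)
open Summit.QuantumFields.YangMills.Cruxes.OSLegsFromFemtoAndGap.DlrCollarTransfer
open Summit.QuantumFields.YangMills.Theorems.OSLegsFromFemtoAndGap
  (torusE_comp_configShift torusE_plane_eq_wilsonTorusMean torusE_prod_plane_eq_torusMomentStr plane_torusLift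
    permPlane permSites permPlane_valid torusMomentStr_coordPerm wilsonTorusMean_permPlane)
open Summit.QuantumFields.YangMills.Theorems.InfVolRP (reflSite reflSite_apply_zero reflSite_apply_of_ne plane_cfgReflect)
open Summit.QuantumFields.YangMills.Cruxes.NT.ConjugateResponse (torusE_comp_cfgReflect cov_negReflect_self_nonneg)
open Summit.QuantumFields.YangMills.Cruxes.NT.MarkovMirror (dependsOn_posHalf_of_window)
open Summit.QuantumFields.YangMills.Cruxes.NT.Reflection (sq_cov_negReflect_le_odd_pos)

namespace Summit.QuantumFields.YangMills.Theorems.MirrorDomination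

variable (G : Type) [Group G] [TopologicalSpace G] [IsTopologicalGroup G] [CompactSpace G]
  [MeasurableSpace G] [BorelSpace G] (r : LatticeRep G)

/-! ## §1 Elementary symmetries of the torus covariance of two plane fields -/

/-- The mean of a plane field does not depend on its base point. [folklore] -/
theorem torusE_plane_site (β : ℝ) (L : ℕ) (q : Fin 4 × Fin 4) (x y : Site 4) :
    torusE G r β L (plane G r q x) = torusE G r β L (plane G r q y) := by
  rw [torusE_plane_eq_wilsonTorusMean, torusE_plane_eq_wilsonTorusMean]

/-- Translation invariance of the torus state on observables of the lift: `E_T[O ∘ θ_{−v}] = E_T[O]`. [folklore] -/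
theorem torusE_comp_shift (β : ℝ) (L : ℕ) (O : LGConfig 4 G → ℝ) (v : Site 4) :
    torusE G r β L (O ∘ configShift (-v)) = torusE G r β L O :=
  torusE_comp_configShift r β L O v

/-- **Translation invariance of the centred two-point function** of plane fields. [folklore] -/
theorem cov_translate (β : ℝ) (L : ℕ) (q q' : Fin 4 × Fin 4) (x y v : Site 4) :
    torusE G r β L (fun U => (plane G r q (x + v) U - torusE G r β L (plane G r q (x + v))) *
        (plane G r q' (y + v) U - torusE G r β L (plane G r q' (y + v)))) =
      torusE G r β L (fun U => (plane G r q x U - torusE G r β L (plane G r q x)) *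
        (plane G r q' y U - torusE G r β L (plane G r q' y))) := by
  rw [torusE_plane_site G r β L q (x + v) x, torusE_plane_site G r β L q' (y + v) y]
  have h : (fun U => (plane G r q (x + v) U - torusE G r β L (plane G r q x)) *
        (plane G r q' (y + v) U - torusE G r β L (plane G r q' y))) =
      (fun U => (plane G r q x U - torusE G r β L (plane G r q x)) *
        (plane G r q' y U - torusE G r β L (plane G r q' y))) ∘ configShift (-v) := by
    funext U
    simp only [Function.comp_apply, Summit.QuantumFields.YangMills.Theorems.InfiniteVolume.plane_add r]
  rw [h, torusE_comp_shift]

/-- **Symmetry** of the centred two-point function. [folklore] -/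
theorem cov_symm (β : ℝ) (L : ℕ) (q q' : Fin 4 × Fin 4) (x y : Site 4) :
    torusE G r β L (fun U => (plane G r q x U - torusE G r β L (plane G r q x)) *
        (plane G r q' y U - torusE G r β L (plane G r q' y))) =
      torusE G r β L (fun U => (plane G r q' y U - torusE G r β L (plane G r q' y)) *
        (plane G r q x U - torusE G r β L (plane G r q x))) := by
  congr 1
  funext U
  ring

omit [IsTopologicalGroup G] [CompactSpace G] [BorelSpace G] in
/-- **Torus aliasing** of the plane fields read through the periodic lift: base points differing by a multiple of the
side `2L+1` give the same function of the torus configuration. [folklore] -/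
theorem plane_torusLift_add_period (L : ℕ) (q : Fin 4 × Fin 4) (x w : Site 4) (U : GaugeConfig 4 (2 * L + 1) G) :
    plane G r q (x + ((2 * L + 1 : ℕ) : ℤ) • w) (torusLift (2 * L + 1) U) = plane G r q x (torusLift (2 * L + 1) U) := by
  rw [plane_torusLift, plane_torusLift]
  exact HypercubicLimit.Negative.torusPlaquette_add_natCast_smul r (2 * L + 1) q.1 q.2 x w U

/-- **Periodicity** of the centred two-point function in the second base point. [folklore] -/
theorem cov_add_period (β : ℝ) (L : ℕ) (q q' : Fin 4 × Fin 4) (x y w : Site 4) :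
    torusE G r β L (fun U => (plane G r q x U - torusE G r β L (plane G r q x)) *
        (plane G r q' (y + ((2 * L + 1 : ℕ) : ℤ) • w) U -
          torusE G r β L (plane G r q' (y + ((2 * L + 1 : ℕ) : ℤ) • w)))) =
      torusE G r β L (fun U => (plane G r q x U - torusE G r β L (plane G r q x)) *
        (plane G r q' y U - torusE G r β L (plane G r q' y))) := by
  rw [torusE_plane_site G r β L q' (y + ((2 * L + 1 : ℕ) : ℤ) • w) y]
  unfold torusE
  simp_rw [plane_torusLift_add_period]

/-- **Uncentring**: `E[(P − EP)(P' − EP')] = E[P P'] − EP·EP'`. [folklore] -/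
theorem cov_eq_sub (β : ℝ) (L : ℕ) (q q' : Fin 4 × Fin 4) (x y : Site 4) :
    torusE G r β L (fun U => (plane G r q x U - torusE G r β L (plane G r q x)) *
        (plane G r q' y U - torusE G r β L (plane G r q' y))) =
      torusE G r β L (fun U => plane G r q x U * plane G r q' y U) -
        torusE G r β L (plane G r q x) * torusE G r β L (plane G r q' y) := by
  rw [Summit.QuantumFields.YangMills.Cruxes.NT.CumulantPolarisation.torusE_centred_centred G r β L (continuous_plane r q x) (continuous_plane r q' y)]
  ring


/-! ## §2 Reflection-positivity Cauchy–Schwarz for a pair of plane fields on the odd torus -/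

/-- The window condition of a plane field based at a site of time in `[0, L−2]`: every link of its support has base time
in `[0, L−1]`. [folklore] -/
theorem window_of_plane (L : ℕ) (q : Fin 4 × Fin 4) (x : Site 4) (hx0 : 0 ≤ x 0) (hxL : x 0 + 2 ≤ (L : ℤ)) :
    ∀ e ∈ (originPlaquetteSupport q.1 q.2).image (fun e : Literature.MathematicalPhysics.QuantumLattice.ZdEdge 4 => (e.1 - -x, e.2)),
      0 ≤ e.1 0 ∧ e.1 0 + 1 ≤ (L : ℤ) := by
  intro e he
  have h := near_of_mem_supp_plane he 0
  constructor <;> omega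

/-- **Reflection-positivity Cauchy–Schwarz for two plane fields** (`β ≥ 0`, odd torus `2L+1`, `L ≥ 1`): if `P_q(x)` and
`P_q'(y)` are based at times in `[0, L−2]` (closed non-negative half), then
`Cov(P_q(θx), P_q'(y))² ≤ Cov(P_q(θx), P_q(x)) · Cov(P_q'(θy), P_q'(y))`, `θ = reflSite` the base site of the reflected
plaquette (tree `plane_cfgReflect`), and both mirror covariances are `≥ 0`.
[cite: FrohlichIsraelLiebSimon1978, Thm. 2.1; OsterwalderSeiler1978, §2] -/
theorem rpcs_plane {β : ℝ} (hβ : 0 ≤ β) {L : ℕ} (hL : 1 ≤ L) {q q' : Fin 4 × Fin 4} (hq : q.1 < q.2)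
    (hq' : q'.1 < q'.2) (x y : Site 4) (hx0 : 0 ≤ x 0) (hxL : x 0 + 2 ≤ (L : ℤ)) (hy0 : 0 ≤ y 0)
    (hyL : y 0 + 2 ≤ (L : ℤ)) :
    (torusE G r β L (fun U => plane G r q (reflSite q x) U * plane G r q' y U) -
        torusE G r β L (plane G r q x) * torusE G r β L (plane G r q' y)) ^ 2 ≤
      (torusE G r β L (fun U => plane G r q (reflSite q x) U * plane G r q x U) -
          torusE G r β L (plane G r q x) ^ 2) *
        (torusE G r β L (fun U => plane G r q' (reflSite q' y) U * plane G r q' y U) -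
          torusE G r β L (plane G r q' y) ^ 2) ∧
    0 ≤ torusE G r β L (fun U => plane G r q (reflSite q x) U * plane G r q x U) -
          torusE G r β L (plane G r q x) ^ 2 ∧
    0 ≤ torusE G r β L (fun U => plane G r q' (reflSite q' y) U * plane G r q' y U) -
          torusE G r β L (plane G r q' y) ^ 2 := by
  haveI := r.secondCountableTopology
  obtain ⟨C, hC⟩ := exists_abs_plane_le (G := G) r
  set F : GaugeConfig 4 (2 * L + 1) G → ℝ := fun U => plane G r q x (torusLift (2 * L + 1) U) with hF
  set H : GaugeConfig 4 (2 * L + 1) G → ℝ := fun U => plane G r q' y (torusLift (2 * L + 1) U) with hH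
  have hFm : Measurable F := ((continuous_plane r q x).comp (continuous_torusLift _)).measurable
  have hHm : Measurable H := ((continuous_plane r q' y).comp (continuous_torusLift _)).measurable
  have hFb : ∃ K : ℝ, ∀ U, |F U| ≤ K := ⟨C, fun U => hC q x _⟩
  have hHb : ∃ K : ℝ, ∀ U, |H U| ≤ K := ⟨C, fun U => hC q' y _⟩
  have hFdep := dependsOn_posHalf_of_window (G := G) L (isCylinder_plane r q x) (window_of_plane L q x hx0 hxL)
  have hHdep := dependsOn_posHalf_of_window (G := G) L (isCylinder_plane r q' y) (window_of_plane L q' y hy0 hyL)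
  have key := sq_cov_negReflect_le_odd_pos (d := 4) (L := 2 * L + 1) r.ρ rfl hL r.continuous hβ hFm hHm hFb hHb
    hFdep hHdep
  have hF0 := cov_negReflect_self_nonneg r.ρ hL r.continuous hβ hFm hFb hFdep
  have hH0 := cov_negReflect_self_nonneg r.ρ hL r.continuous hβ hHm hHb hHdep
  simp only [hF, hH, torusLift_negReflect, plane_cfgReflect r hq, plane_cfgReflect r hq'] at key hF0 hH0
  unfold torusE
  exact ⟨key, hF0, hH0⟩


/-! ## §3 Hypercubic invariance: moving the separated axis to the time axis -/

/-- **Coordinate permutations preserve the centred two-point function** of plane fields (orientations re-sorted by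
`permPlane π`, base points permuted): the `n = 2` case of the tree's `torusMomentStr_coordPerm`. [folklore] -/
theorem cov_coordPerm (β : ℝ) (L : ℕ) (π : Equiv.Perm (Fin 4)) (q q' : Fin 4 × Fin 4) (x y : Site 4) :
    torusE G r β L (fun U =>
        (plane G r (permPlane π q) (fun i => x (π.symm i)) U -
            torusE G r β L (plane G r (permPlane π q) (fun i => x (π.symm i)))) *
          (plane G r (permPlane π q') (fun i => y (π.symm i)) U -
            torusE G r β L (plane G r (permPlane π q') (fun i => y (π.symm i))))) =
      torusE G r β L (fun U => (plane G r q x U - torusE G r β L (plane G r q x)) *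
        (plane G r q' y U - torusE G r β L (plane G r q' y))) := by
  have h2 := torusE_prod_plane_eq_torusMomentStr (G := G) r β L ![q, q'] ![x, y]
  have h2' := torusE_prod_plane_eq_torusMomentStr (G := G) r β L (fun i => permPlane π (![q, q'] i))
    (permSites π ![x, y])
  have hperm := torusMomentStr_coordPerm (G := G) r β L π ![q, q'] ![x, y]
  simp only [wilsonTorusMean_permPlane] at h2'
  rw [← hperm, ← h2] at h2'
  simp only [Fin.prod_univ_two, Matrix.cons_val_zero, Matrix.cons_val_one] at h2'
  exact h2'

end Summit.QuantumFields.YangMills.Theorems.MirrorDomination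

end
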